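import Mathlib.AlgebraicGeometry.Fiber
import Literature.AlgebraicGeometry.AbelianSchemes.AbelianSchemeOverCommOfReduced
import Literature.AlgebraicGeometry.Morphisms.GlobalSectionsProperWithSection
import Literature.AlgebraicGeometry.Motives.AbelianVarietyRigidity
import Literature.AlgebraicGeometry.Resolution.ReducedOfSmoothOverReduced
import HarnessLib

/-!
# Morphisms of abelian schemes preserving the unit section are homomorphisms; abelian schemes are commutative
# — [MumfordFogartyKirwan1994, Ch. 6 §1, Cor. 6.4 and Cor. 6.5] over an ARBITRARY base with reduced `X ×_S X`

[MumfordFogartyKirwan1994, Ch. 6 §1, p. 117]: Cor. 6.4 «Let `X` and `Y` be abelian schemes over `S` … if `f : X → Y` is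
an `S`-morphism such that `f ∘ ε_X = ε_Y`, then `f` is a homomorphism», Cor. 6.5 «If `X` is an abelian scheme over `S`,
then `X` is a commutative group scheme».  In print both are corollaries of the RIGIDITY LEMMA Prop. 6.1 (connected base,
`p_* 𝒪_X = 𝒪_S` universally, Artin-ring thickenings), which neither Mathlib nor the tree has over a base.

THIS FILE proves both corollaries over an ARBITRARY base scheme `S` under the single hypothesis that the total space of
`X ×_S X` is REDUCED — in particular for every abelian scheme over a reduced locally Noetherian base (§3) — by the
fibrewise road: an equation between two `S`-morphisms out of the reduced scheme `X ×_S X` into the `S`-separated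
scheme `Y` holds as soon as it holds after composition with every residue-field point `Spec κ(z) → X ×_S X` (Mathlib
`ext_of_fromSpecResidueField_eq`, [GortzWedhorn2020] Prop. 9.2 / EGA IV 17.9 style); such a point lies in ONE fibre over
the field-valued point `s : Spec κ(z) → S`, where `X_s`, `Y_s` are abelian varieties over `κ(z)` and the statements are
the tree's field-level rigidity corollaries ★ `Motives.isMonHom_of_one_comp` ([Milne1986AbelianVarieties] Cor. 2.2) and
★ `Motives.AbelianVariety.instIsCommMonObj` (Mathlib `isCommMonObj_of_isProper_of_geometricallyIntegral`), transported
back through the cartesian-monoidal base change `Over.pullback s` (★ `AbelianSchemeOverCommOfReduced`: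
`FibrePoints.mul_comm`, `FibrePoints.eq_of_pullback_map_eq`, `comp_mul_left_eq`).  This removes the hypothesis
«`S` locally of finite type and separated over a field» of ★ `AbelianSchemeOver.isCommMonObj_of_isReduced` (which
used `K̄`-points) and adds Cor. 6.4.

Main statements (namespace `Literature.AlgebraicGeometry.AbelianSchemes.AbelianSchemeOver`):
* `isCommMonObj_of_isReduced_tensor` — Cor. 6.5 over any `S`, given `IsReduced (A.X ⊗ A.X).left`;
* `isMonHom_of_one_comp` — Cor. 6.4 over any `S`, given `IsReduced (A.X ⊗ A.X).left`;
* `isReduced_tensor_left`, `isCommMonObj_of_isReduced_base`, `isMonHom_of_one_comp_of_isReduced_base` — the case of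
  a reduced locally Noetherian base (★ `Resolution.isReduced_of_smooth_of_isReduced_base`, Stacks 034E);
* `surjective_appTop_fiberToSpecResidueField` — `H⁰(X_s, 𝒪_{X_s}) = κ(s)` for every fibre (the standing hypothesis of
  the rigidity lemma Prop. 6.1, in Mathlib's `Scheme.Hom.fiber` currency; ★ `Morphisms.bijective_algebraMapΓ_of_universallyClosed_of_section`).

Theorems only; NO instance is declared (consumers take `haveI := A.isCommMonObj_of_isReduced_base`).  Cell
hodgecm-mathlib, seat B-p18 (g13); `B-plan/M1PRIME-DAG.md` §3 N0 («rigidity over `S`» LACKS) / P33.  HC_CM is proved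
only modulo the 7 printed citations until rung 0 closes; this file discharges none of them.

## References
* [MumfordFogartyKirwan1994] D. Mumford, J. Fogarty, F. Kirwan, *Geometric Invariant Theory*, 3rd ed. (1994), Ch. 6 §1:
  Def. 6.1 (p. 115), Prop. 6.1 (Rigidity lemma, pp. 115–116), Cor. 6.4, Cor. 6.5 (p. 117).
* [Milne1986AbelianVarieties] J. S. Milne, *Abelian Varieties*, in Cornell–Silverman (1986), §2 Cor. 2.2 (p. 104).
* [MumfordAV1970] D. Mumford, *Abelian Varieties*, §4 (rigidity lemma and its corollaries; group law on points).
* [GortzWedhorn2020] U. Görtz, T. Wedhorn, *Algebraic Geometry I*, 2nd ed. (2020), Section (4.7) with (4.7.1), Prop. 9.2.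
* [StacksProject] Tag 034E (smooth over reduced is reduced).
-/

noncomputable section

universe u

open CategoryTheory CategoryTheory.Limits AlgebraicGeometry MonoidalCategory CartesianMonoidalCategory
open scoped MonObj CategoryTheory.Obj

namespace Literature.AlgebraicGeometry.AbelianSchemes

namespace AbelianSchemeOver

variable {S : Scheme.{u}} (A : AbelianSchemeOver S)

/-! ### §1 Commutativity (Cor. 6.5) over an arbitrary base from reducedness of `X ×_S X` -/

/-- The structure morphism of an abelian scheme is separated (it is proper). [cite: MumfordFogartyKirwan1994, Ch. 6 §1 Definition 6.1 (p. 115)] -/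
theorem isSeparated_hom : IsSeparated A.X.hom := by
  haveI := A.isProper
  infer_instance

/-- **COMMUTATIVITY OVER AN ARBITRARY BASE** ([MumfordFogartyKirwan1994] Cor. 6.5, reduced-product form): if the
total space of `X ×_S X` is reduced, the abelian scheme `X/S` is a commutative group scheme.  Proof: `μ` and
`μ ∘ swap : X ×_S X → X` are `S`-morphisms from a reduced scheme to the `S`-separated `X`; they agree after every
residue-field point `Spec κ(z) → X ×_S X` by `FibrePoints.mul_comm` (the point lies in one fibre, an abelian variety),
and Mathlib's `ext_of_fromSpecResidueField_eq` concludes.  A theorem, not an instance.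
[cite: MumfordFogartyKirwan1994, Ch. 6 §1 Corollary 6.5 (p. 117)] [cite: MumfordAV1970, §4] -/
theorem isCommMonObj_of_isReduced_tensor [IsReduced (A.X ⊗ A.X).left] : IsCommMonObj A.X where
  mul_comm := by
    haveI := A.isSeparated_hom
    ext : 1
    refine ext_of_fromSpecResidueField_eq _ _ A.X.hom Set.univ dense_univ (fun z _ => ?_) ?_
    · have h1 := A.comp_braiding_mul_left_eq (Ω := ↥((A.X ⊗ A.X).left.residueField z))
        ((A.X ⊗ A.X).left.fromSpecResidueField z)
      have h2 := A.comp_mul_left_eq (Ω := ↥((A.X ⊗ A.X).left.residueField z))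
        ((A.X ⊗ A.X).left.fromSpecResidueField z)
      rw [FibrePoints.mul_comm] at h1
      exact h1.trans h2.symm
    · rw [Over.w, Over.w]

/-! ### §2 A unit-preserving `S`-morphism of abelian schemes is a homomorphism (Cor. 6.4) -/

variable {A} {B : AbelianSchemeOver S}

/-- Base change of a unit-preserving `S`-morphism `f : X → Y` of abelian schemes to a field-valued point
`s : Spec Ω → S` is a HOMOMORPHISM `X_s → Y_s` of the fibre group schemes: `X_s`, `Y_s` are abelian varieties over `Ω`
(`AbelianScheme.toAbelianVariety`), `f_s` preserves the unit (`Functor.obj.η_def`), and a morphism of abelian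
varieties preserving the origin is a homomorphism (★ `Motives.isMonHom_of_one_comp`, [Milne1986AbelianVarieties]
Cor. 2.2 = [MumfordFogartyKirwan1994] Cor. 6.4 over a field). [cite: Milne1986AbelianVarieties, §2 Cor. 2.2 (p. 104)] -/
theorem isMonHom_pullback_map_of_one_comp (f : A.X ⟶ B.X) (hf : η[A.X] ≫ f = η[B.X]) {Ω : Type u} [Field Ω]
    (s : Spec (.of Ω) ⟶ S) : IsMonHom ((Over.pullback s).map f) := by
  have h : η[(A.fibre s).toAbelianVariety.X] ≫ (Over.pullback s).map f = η[(B.fibre s).toAbelianVariety.X] := by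
    change η[(Over.pullback s).obj A.X] ≫ (Over.pullback s).map f = η[(Over.pullback s).obj B.X]
    rw [Functor.obj.η_def, Functor.obj.η_def, Category.assoc, ← Functor.map_comp, hf]
  exact Literature.AlgebraicGeometry.Motives.isMonHom_of_one_comp
    (A := (A.fibre s).toAbelianVariety) (B := (B.fibre s).toAbelianVariety) ((Over.pullback s).map f) h

/-- **A unit-preserving `S`-morphism is multiplicative on field-valued fibre points**: for `x, y ∈ X_s(Ω)`,
`f (x · y) = f x · f y` — base-change to the fibre (`Functor.map_mul` for the cartesian-monoidal `Over.pullback s`),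
use `isMonHom_pullback_map_of_one_comp` there (`MonObj.mul_comp`), and come back by
★ `FibrePoints.eq_of_pullback_map_eq`. [cite: MumfordAV1970, §4] -/
theorem FibrePoints.mul_comp_eq_of_one_comp (f : A.X ⟶ B.X) (hf : η[A.X] ≫ f = η[B.X]) {Ω : Type u} [Field Ω]
    {s : Spec (.of Ω) ⟶ S} (x y : A.FibrePoints s) :
    (x * y) ≫ f = (x ≫ f) * (y ≫ f) := by
  haveI := isMonHom_pullback_map_of_one_comp f hf s
  apply FibrePoints.eq_of_pullback_map_eq B s
  rw [Functor.map_comp, Functor.map_mul, MonObj.mul_comp, Functor.map_mul, Functor.map_comp, Functor.map_comp]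

/-- An `Ω`-point `P` of `X ×_S X` with components `x, y ∈ X_s(Ω)` satisfies `P ≫ ((f × f) ≫ μ_Y) = (f x · f y)` on
underlying morphisms (group law on points, [MumfordAV1970] §4; Mathlib `Hom.mul_def`, `tensorHom_fst/snd`).
[cite: MumfordAV1970, §4] -/
theorem comp_tensorHom_mul_left_eq (f : A.X ⟶ B.X) {Ω : Type u} [Field Ω] (P : Spec (.of Ω) ⟶ (A.X ⊗ A.X).left) :
    P ≫ ((f ⊗ₘ f) ≫ μ[B.X]).left =
      (((Over.homMk (U := Over.mk (P ≫ (A.X ⊗ A.X).hom)) (V := A.X ⊗ A.X) P rfl ≫ fst A.X A.X) ≫ f) *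
        ((Over.homMk (U := Over.mk (P ≫ (A.X ⊗ A.X).hom)) (V := A.X ⊗ A.X) P rfl ≫ snd A.X A.X) ≫ f)).left := by
  have h : Over.homMk (U := Over.mk (P ≫ (A.X ⊗ A.X).hom)) (V := A.X ⊗ A.X) P rfl ≫ (f ⊗ₘ f) =
      lift ((Over.homMk (U := Over.mk (P ≫ (A.X ⊗ A.X).hom)) (V := A.X ⊗ A.X) P rfl ≫ fst A.X A.X) ≫ f)
        ((Over.homMk (U := Over.mk (P ≫ (A.X ⊗ A.X).hom)) (V := A.X ⊗ A.X) P rfl ≫ snd A.X A.X) ≫ f) := by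
    rw [← lift_fst_comp_snd_comp, comp_lift, Category.assoc, Category.assoc]
  change (Over.homMk (U := Over.mk (P ≫ (A.X ⊗ A.X).hom)) (V := A.X ⊗ A.X) P rfl ≫ (f ⊗ₘ f) ≫ μ[B.X]).left = _
  rw [← Category.assoc, h, Hom.mul_def]

/-- **[MumfordFogartyKirwan1994] Cor. 6.4 OVER AN ARBITRARY BASE (reduced-product form)**: let `X`, `Y` be abelian
schemes over `S` with the total space of `X ×_S X` reduced, and `f : X → Y` an `S`-morphism with `f ∘ ε_X = ε_Y`.  Then
`f` is a homomorphism of `S`-group schemes.  Proof: `μ_X ≫ f` and `(f × f) ≫ μ_Y : X ×_S X → Y` are `S`-morphisms from a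
reduced scheme into the `S`-separated `Y`; after every residue-field point of `X ×_S X` they read `f (x · y)` and
`f x · f y` for the two components `x, y ∈ X_s(κ)` (`comp_mul_left_eq`, `comp_tensorHom_mul_left_eq`), which agree by
`FibrePoints.mul_comp_eq_of_one_comp`; Mathlib `ext_of_fromSpecResidueField_eq` concludes.
[cite: MumfordFogartyKirwan1994, Ch. 6 §1 Corollary 6.4 (p. 117)] [cite: Milne1986AbelianVarieties, §2 Cor. 2.2 (p. 104)] -/
theorem isMonHom_of_one_comp [IsReduced (A.X ⊗ A.X).left] (f : A.X ⟶ B.X) (hf : η[A.X] ≫ f = η[B.X]) :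
    IsMonHom f where
  one_hom := hf
  mul_hom := by
    haveI := B.isSeparated_hom
    ext : 1
    refine ext_of_fromSpecResidueField_eq _ _ B.X.hom Set.univ dense_univ (fun z _ => ?_) ?_
    · have h1 := A.comp_mul_left_eq (Ω := ↥((A.X ⊗ A.X).left.residueField z))
        ((A.X ⊗ A.X).left.fromSpecResidueField z)
      have h2 := comp_tensorHom_mul_left_eq f (Ω := ↥((A.X ⊗ A.X).left.residueField z))
        ((A.X ⊗ A.X).left.fromSpecResidueField z)
      simp only [Over.comp_left] at h1 h2 ⊢
      rw [h2, ← FibrePoints.mul_comp_eq_of_one_comp f hf, Over.comp_left, ← h1]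
      exact (Category.assoc _ _ _).symm
    · rw [Over.w, Over.w]

/-! ### §3 Reduced locally Noetherian bases -/

variable (A)

/-- Over a reduced locally Noetherian base the total space of `X ×_S X` is reduced: `X ×_S X → S` is smooth (base change
and composition of smooth morphisms) and a scheme smooth over a reduced locally Noetherian scheme is reduced
(★ `Resolution.isReduced_of_smooth_of_isReduced_base`, Stacks 034E). [cite: StacksProject, Tag 034E] -/
theorem isReduced_tensor_left [IsReduced S] [IsLocallyNoetherian S] : IsReduced (A.X ⊗ A.X).left := by
  have hAA : Smooth (A.X ⊗ A.X).hom := by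
    rw [Over.tensorObj_hom]
    exact MorphismProperty.comp_mem _ _ _ (MorphismProperty.pullback_fst _ _ A.isSmooth) A.isSmooth
  exact Literature.AlgebraicGeometry.Resolution.isReduced_of_smooth_of_isReduced_base (A.X ⊗ A.X).hom

/-- The total space of an abelian scheme over a reduced locally Noetherian base is reduced (smooth over reduced,
Stacks 034E). [cite: StacksProject, Tag 034E] -/
theorem isReduced_left [IsReduced S] [IsLocallyNoetherian S] : IsReduced A.X.left := by
  haveI := A.isSmooth
  exact Literature.AlgebraicGeometry.Resolution.isReduced_of_smooth_of_isReduced_base A.X.hom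

/-- **[MumfordFogartyKirwan1994] Cor. 6.5 over a reduced locally Noetherian base**: every abelian scheme over such an
`S` is a commutative group scheme.  A theorem, not an instance. [cite: MumfordFogartyKirwan1994, Ch. 6 §1 Corollary 6.5 (p. 117)] -/
theorem isCommMonObj_of_isReduced_base [IsReduced S] [IsLocallyNoetherian S] : IsCommMonObj A.X := by
  haveI := A.isReduced_tensor_left
  exact A.isCommMonObj_of_isReduced_tensor

variable {A}

/-- **[MumfordFogartyKirwan1994] Cor. 6.4 over a reduced locally Noetherian base**: an `S`-morphism of abelian
schemes preserving the unit section is a homomorphism. [cite: MumfordFogartyKirwan1994, Ch. 6 §1 Corollary 6.4 (p. 117)] -/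
theorem isMonHom_of_one_comp_of_isReduced_base [IsReduced S] [IsLocallyNoetherian S] (f : A.X ⟶ B.X)
    (hf : η[A.X] ≫ f = η[B.X]) : IsMonHom f := by
  haveI := A.isReduced_tensor_left
  exact isMonHom_of_one_comp f hf

/-! ### §4 Global functions on the fibres: `H⁰(X_s, 𝒪_{X_s}) = κ(s)` -/

variable (A)

/-- **`H⁰(X_s, 𝒪_{X_s}) = κ(s)` for every fibre of an abelian scheme** — the standing hypothesis of the rigidity lemma
[MumfordFogartyKirwan1994] Prop. 6.1 / Cor. 6.2–6.3, in the form «the pull-back `κ(s) → Γ(X_s, 𝒪)` along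
`X_s → Spec κ(s)` (Mathlib `Scheme.Hom.fiberToSpecResidueField`) is onto»: the scheme-theoretic fibre `X_s` is an
abelian variety over `κ(s)` (`fibre`, `AbelianScheme.toAbelianVariety`), a proper integral `κ(s)`-scheme with the
rational point `ε(s)`, so its global functions are the constants (★ `Morphisms.bijective_algebraMapΓ_of_universallyClosed_of_section`,
[Hartshorne1977] II Ex. 4.5(d) / Stacks 0BUG). [cite: MumfordFogartyKirwan1994, Ch. 6 §1 Proposition 6.1 (pp. 115–116), hypothesis] -/
theorem surjective_appTop_fiberToSpecResidueField (s : S) :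
    Function.Surjective (A.X.hom.fiberToSpecResidueField s).appTop.hom := by
  let t : Spec (.of (S.residueField s)) ⟶ S := S.fromSpecResidueField s
  let B : Literature.AlgebraicGeometry.Motives.AbelianVariety (S.residueField s) := (A.fibre t).toAbelianVariety
  haveI : IsIntegral B.X.left := GeometricallyIntegral.isIntegral_of_subsingleton B.X.hom
  have hbij := Literature.AlgebraicGeometry.Morphisms.bijective_algebraMapΓ_of_universallyClosed_of_section B.X.hom
    (η[B.X]).left (Over.w η[B.X])
  exact Function.Surjective.of_comp
    (hbij.2 : Function.Surjective (⇑B.X.hom.appTop.hom ∘ ⇑(Scheme.ΓSpecIso (.of (S.residueField s))).inv.hom))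

/-- The same in Mumford's words: every global function on the fibre `X_s` is a constant from `κ(s)` — `Γ(X_s, 𝒪)` is
the image of `Γ(Spec κ(s), 𝒪) = κ(s)`. [cite: MumfordFogartyKirwan1994, Ch. 6 §1 Proposition 6.1 (pp. 115–116), hypothesis] -/
theorem exists_appTop_fiberToSpecResidueField_eq (s : S) (φ : Γ(A.X.hom.fiber s, ⊤)) :
    ∃ c : Γ(Spec (S.residueField s), ⊤), (A.X.hom.fiberToSpecResidueField s).appTop.hom c = φ :=
  A.surjective_appTop_fiberToSpecResidueField s φ

end AbelianSchemeOver

end Literature.AlgebraicGeometry.AbelianSchemes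

end
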